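import Mathlib
import Literature.Probability.Percolation.Percolation
import Literature.Probability.Percolation.IkhlefPonsaingFirstPassage
import Literature.Probability.Percolation.IkhlefPonsaingFirstPassageProofs
import Literature.Probability.Percolation.DiagonalColumnPatterns
import Literature.Probability.Percolation.DiagonalStripJunction
import Literature.Probability.Percolation.DiagonalStripTransferLaw
import Literature.Probability.Percolation.DiagonalStripTransferExplicit
import Literature.Probability.Percolation.DiagonalStripDoeblin
import Literature.Probability.Percolation.DiagonalStripStationary
import Literature.Probability.Percolation.DiagonalStripPlanarity
import Literature.Combinatorics.Enumerative.SymplecticCharacterVSASM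
import HarnessLib

/-!
# Lumping the column patterns onto link patterns (Ikhlef–Ponsaing, wired wall)

Topic `Literature/Probability/Percolation`. Bridge step (B1b) between the dictionary of the named
fact `Literature.Probability.Percolation.IkhlefPonsaingFirstPassage` (Ikhlef–Ponsaing, J. Stat.
Phys. 149 (2012), arXiv:1202.5476) and IP12's own state space: in IP12 the wall is WIRED (§2.2),
so all sites joined to the wall form ONE boundary cluster, whereas the column patterns
`P = (P.1, P.2)` of `DiagonalColumnPatterns.lean` remember which wall-joined sites are joined to
each other inside the strip. The lumping map `lump` merges the flagged classes:

* `lump`, `lump_lump`, `lump_eq_self_iff`, `lump_isValid`, `lump_isPlanar`;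
  `snd_eq_fst_zero_of_lump_eq` / `isValid_isPlanar_lump_of_noncross` — at even columns the
  lump-fixed valid planar patterns are exactly the NON-CROSSING equivalence relations on the
  `m + 1` column sites with flags "the class of the bottom site" (`C_{m+1} = |LP_{2m+1}|` states);
* **lumpability**: `eqvGen_updRel_lump_iff`, **`lump_colUpdate_lump`** (the lumped new pattern only
  depends on the lumped old pattern), **`ipJunction_lump_lump`** (`J(lump P, lump P') = J(P, P')`);
* lumped laws: `lumpLaw` (push-forward), `ipTransferL` (`T̄_c(Q,Q') = ∑_{lump P' = Q'} T_c(Q,P')`),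
  `pushLawL`, **`lumpLaw_pushLaw`** (`lump_* (μ T_c) = (lump_* μ) T̄_c`), `ipStationaryL m := lump_* π_m`
  with `sum_ipStationaryL`, **`pushLawL_pushLawL_ipStationaryL`** (`π̄ = π̄ T̄₀ T̄₁`) and
  **`eq_ipStationaryL_of_fixed`** (uniqueness of the lumped stationary law — this is how a
  candidate ground state computed on link patterns is to be identified with `π̄`);
* **`ikhlefPonsaingFirstPassage_iff_lumped_pairing`** — the named fact is equivalent to
  `∑_{Q,Q'} π̄_m(Q) π̄_m(Q') J_m(Q,Q') = ipSpDim(2m) ipSpDim(2m+2) / ipSpDim(2m+1)²` (`m ∈ ℕ`), IP12's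
  `⟨Ψ|ρ|Ψ⟩/⟨Ψ|Ψ⟩ = χ_{L-1} χ_{L+1} / χ_L²` (Def. 4.1, Prop. 4.5) at the homogeneous point, on a
  state space in bijection with `LP_{2m+1}`; its proof is the `q`KZ computation of IP12 §3.3–§4.4
  (not formalised here).

## References

* Y. Ikhlef, A. K. Ponsaing, J. Stat. Phys. 149 (2012) 10–36, arXiv:1202.5476, §2.2, §3.1, §3.4,
  Def. 4.1, Props. 4.5, 4.7. [IkhlefPonsaing2012]
-/

namespace Literature.Probability.Percolation

open Literature.Probability.LatticeModels

/-! ### The lumping map: merging the wall-flagged classes -/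

section Lump

variable {m : ℕ}

/-- **Lumping**: all sites joined to the wall are merged into one class (IP12's wall is WIRED:
in the link-pattern language all wall contacts belong to the boundary cluster); the flags are
kept. [cite: IkhlefPonsaing2012, §2.2, §3.1] -/
def lump (P : ColPattern m) : ColPattern m :=
  (fun i j => P.1 i j || (P.2 i && P.2 j), P.2)

/-- The flags are unchanged. [folklore] -/
@[simp] theorem lump_snd (P : ColPattern m) : (lump P).2 = P.2 := rfl

/-- The lumped relation. [folklore] -/
theorem lump_fst (P : ColPattern m) (i j : Fin (m + 1)) :
    (lump P).1 i j = (P.1 i j || (P.2 i && P.2 j)) := rfl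

/-- The lumped relation, in `Prop`. [folklore] -/
theorem lump_fst_eq_true_iff (P : ColPattern m) (i j : Fin (m + 1)) :
    (lump P).1 i j = true ↔ P.1 i j = true ∨ (P.2 i = true ∧ P.2 j = true) := by
  rw [lump_fst, Bool.or_eq_true, Bool.and_eq_true]

/-- Lumping is idempotent. [folklore] -/
theorem lump_lump (P : ColPattern m) : lump (lump P) = lump P := by
  refine Prod.ext (funext fun i => funext fun j => ?_) rfl
  simp only [lump_fst, lump_snd]
  cases P.1 i j <;> cases P.2 i <;> cases P.2 j <;> rfl

/-- The fixed points of lumping: the flagged sites form (at most) one class. [folklore] -/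
theorem lump_eq_self_iff (P : ColPattern m) :
    lump P = P ↔ ∀ i j, P.2 i = true → P.2 j = true → P.1 i j = true := by
  constructor
  · intro h i j hi hj
    have := congrArg (fun Q : ColPattern m => Q.1 i j) h
    simp only [lump_fst, hi, hj, Bool.and_self, Bool.or_true] at this
    exact this.symm
  · intro h
    refine Prod.ext (funext fun i => funext fun j => ?_) rfl
    rw [lump_fst]
    cases hi : P.2 i <;> cases hj : P.2 j <;> simp [h i j, hi, hj]

/-- Lumping preserves validity. [folklore] -/
theorem lump_isValid {c : ℤ} {P : ColPattern m} (hP : IsValid c P) : IsValid c (lump P) := by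
  refine ⟨fun i => ?_, fun i j h => ?_, fun i j k h1 h2 => ?_, fun i j h hw => ?_, fun hc => ?_⟩
  · rw [lump_fst_eq_true_iff]; exact Or.inl (hP.refl i)
  · rw [lump_fst_eq_true_iff] at h ⊢
    exact h.imp (hP.symm _ _) And.symm
  · rw [lump_fst_eq_true_iff] at h1 h2 ⊢
    rcases h1 with h1 | ⟨hi, hj⟩ <;> rcases h2 with h2 | ⟨hj', hk⟩
    · exact Or.inl (hP.trans _ _ _ h1 h2)
    · exact Or.inr ⟨hP.wall _ _ (hP.symm _ _ h1) hj', hk⟩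
    · exact Or.inr ⟨hi, hP.wall _ _ h2 hj⟩
    · exact Or.inr ⟨hi, hk⟩
  · rw [lump_snd] at hw ⊢
    rw [lump_fst_eq_true_iff] at h
    rcases h with h | ⟨_, hj⟩
    · exact hP.wall _ _ h hw
    · exact hj
  · exact hP.bottom hc

/-- Lumping preserves planarity (of valid patterns). [folklore] -/
theorem lump_isPlanar {c : ℤ} {P : ColPattern m} (hP : IsValid c P) (hPl : IsPlanar P) :
    IsPlanar (lump P) := by
  refine ⟨fun i j k l hij hjk hkl hik hjl => ?_, fun i j k hij hjk hik hj => ?_⟩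
  · rw [lump_fst_eq_true_iff] at hik hjl ⊢
    rcases hik with hik | ⟨hi, hk⟩ <;> rcases hjl with hjl | ⟨hj, hl⟩
    · exact Or.inl (hPl.noncross i j k l hij hjk hkl hik hjl)
    · exact Or.inl (hPl.wall_nested i j k hij hjk hik hj)
    · exact Or.inr ⟨hi, hP.wall _ _ (hP.symm _ _ (hPl.wall_nested j k l hjk hkl hjl hk)) hk⟩
    · exact Or.inr ⟨hi, hj⟩
  · rw [lump_snd] at hj
    rw [lump_fst_eq_true_iff] at hik ⊢
    rcases hik with hik | ⟨hi, _⟩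
    · exact Or.inl (hPl.wall_nested i j k hij hjk hik hj)
    · exact Or.inr ⟨hi, hj⟩

/-- **The lumped even-column states are the non-crossing partitions**: a valid planar even-column
pattern fixed by lumping is a non-crossing equivalence relation `P.1` on the `m + 1` column sites
together with the flags `P.2 = (class of the bottom site 0)`; there are `C_{m+1} = |LP_{2m+1}|`
of them. [cite: IkhlefPonsaing2012, §3.1] -/
theorem snd_eq_fst_zero_of_lump_eq {c : ℤ} (hc : c % 2 = 0) {P : ColPattern m} (hP : IsValid c P)
    (hL : lump P = P) (i : Fin (m + 1)) : P.2 i = P.1 0 i := by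
  rw [lump_eq_self_iff] at hL
  rw [Bool.eq_iff_iff]
  exact ⟨fun h => hL 0 i (hP.bottom hc) h, fun h => hP.wall _ _ h (hP.bottom hc)⟩

/-- Conversely, at an even column, a non-crossing equivalence relation with flags "the class of
the bottom site" is a valid planar pattern fixed by lumping. [cite: IkhlefPonsaing2012, §3.1] -/
theorem isValid_isPlanar_lump_of_noncross (c : ℤ) {P : ColPattern m}
    (hrefl : ∀ i, P.1 i i = true) (hsymm : ∀ i j, P.1 i j = true → P.1 j i = true)
    (htrans : ∀ i j k, P.1 i j = true → P.1 j k = true → P.1 i k = true)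
    (hnc : ∀ i j k l : Fin (m + 1), i < j → j < k → k < l → P.1 i k = true → P.1 j l = true → P.1 i j = true)
    (hflag : ∀ i, P.2 i = P.1 0 i) :
    IsValid c P ∧ IsPlanar P ∧ lump P = P := by
  refine ⟨⟨hrefl, hsymm, htrans, fun i j h hw => ?_, fun _ => ?_⟩, ⟨hnc, fun i j k hij hjk hik hj => ?_⟩, ?_⟩
  · rw [hflag] at hw ⊢
    exact htrans _ _ _ hw h
  · rw [hflag]; exact hrefl 0
  · rw [hflag] at hj
    rcases (Fin.zero_le i).lt_or_eq with h0 | h0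
    · exact htrans _ _ _ (hsymm _ _ (hnc 0 i j k h0 hij hjk hj hik)) hj
    · rw [← h0]; exact hj
  · rw [lump_eq_self_iff]
    intro i j hi hj
    rw [hflag] at hi hj
    exact htrans _ _ _ (hsymm _ _ hi) hj

/-! ### Lumpability of the update and of the junction -/

/-- The update's wall contacts only see the flags. [folklore] -/
theorem updWall_lump (c : ℤ) (P : ColPattern m) : updWall m c (lump P) = updWall m c P := by
  funext z
  rcases z with i | j <;> rfl

/-- `updRel P E ≤ updRel (lump P) E`. [folklore] -/
theorem updRel_le_updRel_lump (P : ColPattern m) (E : Fin (m + 1) → Fin (m + 1) → Bool)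
    (x y : Fin (m + 1) ⊕ Fin (m + 1)) (h : updRel m P E x y) : updRel m (lump P) E x y := by
  rcases x with i | j <;> rcases y with i' | j' <;> simp only [updRel] at h ⊢
  · rw [lump_fst_eq_true_iff]; exact Or.inl h
  · exact h
  · exact h

/-- **The closure of the lumped update relation**: two sites are related iff they are related
for the unlumped pattern, or both are joined to OLD wall contacts. [folklore] -/
theorem eqvGen_updRel_lump_iff (P : ColPattern m) (E : Fin (m + 1) → Fin (m + 1) → Bool)
    (x y : Fin (m + 1) ⊕ Fin (m + 1)) :
    Relation.EqvGen (updRel m (lump P) E) x y ↔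
      Relation.EqvGen (updRel m P E) x y ∨
        ((∃ i, Relation.EqvGen (updRel m P E) x (Sum.inl i) ∧ P.2 i = true) ∧
          (∃ i, Relation.EqvGen (updRel m P E) y (Sum.inl i) ∧ P.2 i = true)) := by
  constructor
  · intro h
    induction h with
    | rel a b hr =>
      rcases a with i | j <;> rcases b with i' | j' <;> simp only [updRel] at hr
      · rw [lump_fst_eq_true_iff] at hr
        rcases hr with hr | ⟨hi, hi'⟩
        · exact Or.inl (Relation.EqvGen.rel _ _ hr)
        · exact Or.inr ⟨⟨i, Relation.EqvGen.refl _, hi⟩, ⟨i', Relation.EqvGen.refl _, hi'⟩⟩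
      · exact Or.inl (Relation.EqvGen.rel _ _ hr)
      · exact Or.inl (Relation.EqvGen.rel _ _ hr)
    | refl a => exact Or.inl (Relation.EqvGen.refl _)
    | symm a b _ ih => exact ih.imp (Relation.EqvGen.symm _ _) And.symm
    | trans a b c _ _ ih₁ ih₂ =>
      rcases ih₁ with h1 | ⟨ha, hb⟩ <;> rcases ih₂ with h2 | ⟨hb', hc⟩
      · exact Or.inl (Relation.EqvGen.trans _ _ _ h1 h2)
      · obtain ⟨i, hbi, hi⟩ := hb'
        exact Or.inr ⟨⟨i, Relation.EqvGen.trans _ _ _ h1 hbi, hi⟩, hc⟩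
      · obtain ⟨i, hbi, hi⟩ := hb
        exact Or.inr ⟨ha, ⟨i, Relation.EqvGen.trans _ _ _ (Relation.EqvGen.symm _ _ h2) hbi, hi⟩⟩
      · exact Or.inr ⟨ha, hc⟩
  · rintro (h | ⟨⟨i, hxi, hi⟩, ⟨i', hyi, hi'⟩⟩)
    · exact Relation.EqvGen.mono (updRel_le_updRel_lump P E) x y h
    · have h1 := Relation.EqvGen.mono (updRel_le_updRel_lump P E) _ _ hxi
      have h2 := Relation.EqvGen.mono (updRel_le_updRel_lump P E) _ _ hyi
      have h3 : Relation.EqvGen (updRel m (lump P) E) (Sum.inl i) (Sum.inl i') :=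
        Relation.EqvGen.rel _ _ (by
          simp only [updRel]
          rw [lump_fst_eq_true_iff]
          exact Or.inr ⟨hi, hi'⟩)
      exact Relation.EqvGen.trans _ _ _ h1
        (Relation.EqvGen.trans _ _ _ h3 (Relation.EqvGen.symm _ _ h2))

/-- The update's new flags are the same for `P` and `lump P`. [folklore] -/
theorem exists_eqvGen_updRel_lump_iff (c : ℤ) (P : ColPattern m)
    (E : Fin (m + 1) → Fin (m + 1) → Bool) (x : Fin (m + 1) ⊕ Fin (m + 1)) :
    (∃ z, Relation.EqvGen (updRel m (lump P) E) x z ∧ updWall m c (lump P) z) ↔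
      ∃ z, Relation.EqvGen (updRel m P E) x z ∧ updWall m c P z := by
  rw [updWall_lump]
  constructor
  · rintro ⟨z, hxz, hz⟩
    rcases (eqvGen_updRel_lump_iff P E x z).1 hxz with h | ⟨⟨i, hxi, hi⟩, -⟩
    · exact ⟨z, h, hz⟩
    · exact ⟨Sum.inl i, hxi, hi⟩
  · rintro ⟨z, hxz, hz⟩
    exact ⟨z, (eqvGen_updRel_lump_iff P E x z).2 (Or.inl hxz), hz⟩

/-- **Lumpability of the update**: the lumped new pattern only depends on the lumped old
pattern. [cite: IkhlefPonsaing2012, §3.1] -/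
theorem lump_colUpdate_lump (c : ℤ) (P : ColPattern m) (E : Fin (m + 1) → Fin (m + 1) → Bool) :
    lump (colUpdate m c (lump P) E) = lump (colUpdate m c P E) := by
  classical
  refine Prod.ext (funext fun j => funext fun j' => ?_) (funext fun j => ?_)
  · rw [lump_fst, lump_fst, Bool.eq_iff_iff]
    simp only [Bool.or_eq_true, Bool.and_eq_true, colUpdate, decide_eq_true_eq]
    rw [exists_eqvGen_updRel_lump_iff, exists_eqvGen_updRel_lump_iff, eqvGen_updRel_lump_iff]
    constructor
    · rintro ((h | ⟨⟨i, hji, hi⟩, ⟨i', hj'i, hi'⟩⟩) | h)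
      · exact Or.inl h
      · exact Or.inr ⟨⟨Sum.inl i, hji, hi⟩, ⟨Sum.inl i', hj'i, hi'⟩⟩
      · exact Or.inr h
    · rintro (h | h)
      · exact Or.inl (Or.inl h)
      · exact Or.inr h
  · simp only [lump_snd, colUpdate]
    rw [decide_eq_decide]
    exact exists_eqvGen_updRel_lump_iff c P E _

/-- Lumping factors the update: patterns with the same lumping update to patterns with the same
lumping. [folklore] -/
theorem lump_colUpdate_congr (c : ℤ) {P Q : ColPattern m} (h : lump P = lump Q)
    (E : Fin (m + 1) → Fin (m + 1) → Bool) :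
    lump (colUpdate m c P E) = lump (colUpdate m c Q E) := by
  rw [← lump_colUpdate_lump c P, h, lump_colUpdate_lump]

/-- The closure of the lumped junction relation: related for the unlumped patterns, or both
joined to flagged sites. [folklore] -/
theorem eqvGen_junction_lump (P P' : ColPattern m) (x y : Fin (m + 1))
    (h : Relation.EqvGen (fun i i' : Fin (m + 1) => (lump P).1 i i' = true ∨ (lump P').1 i i' = true) x y) :
    Relation.EqvGen (fun i i' : Fin (m + 1) => P.1 i i' = true ∨ P'.1 i i' = true) x y ∨
      ((∃ f, Relation.EqvGen (fun i i' : Fin (m + 1) => P.1 i i' = true ∨ P'.1 i i' = true) x f ∧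
          (P.2 f = true ∨ P'.2 f = true)) ∧
        (∃ f, Relation.EqvGen (fun i i' : Fin (m + 1) => P.1 i i' = true ∨ P'.1 i i' = true) y f ∧
          (P.2 f = true ∨ P'.2 f = true))) := by
  induction h with
  | rel a b hr =>
    rw [lump_fst_eq_true_iff, lump_fst_eq_true_iff] at hr
    rcases hr with (hr | ⟨ha, hb⟩) | (hr | ⟨ha, hb⟩)
    · exact Or.inl (Relation.EqvGen.rel _ _ (Or.inl hr))
    · exact Or.inr ⟨⟨a, Relation.EqvGen.refl _, Or.inl ha⟩, ⟨b, Relation.EqvGen.refl _, Or.inl hb⟩⟩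
    · exact Or.inl (Relation.EqvGen.rel _ _ (Or.inr hr))
    · exact Or.inr ⟨⟨a, Relation.EqvGen.refl _, Or.inr ha⟩, ⟨b, Relation.EqvGen.refl _, Or.inr hb⟩⟩
  | refl a => exact Or.inl (Relation.EqvGen.refl _)
  | symm a b _ ih => exact ih.imp (Relation.EqvGen.symm _ _) And.symm
  | trans a b c _ _ ih₁ ih₂ =>
    rcases ih₁ with h1 | ⟨ha, hb⟩ <;> rcases ih₂ with h2 | ⟨hb', hc⟩
    · exact Or.inl (Relation.EqvGen.trans _ _ _ h1 h2)
    · obtain ⟨f, hbf, hf⟩ := hb'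
      exact Or.inr ⟨⟨f, Relation.EqvGen.trans _ _ _ h1 hbf, hf⟩, hc⟩
    · obtain ⟨f, hbf, hf⟩ := hb
      exact Or.inr ⟨ha, ⟨f, Relation.EqvGen.trans _ _ _ (Relation.EqvGen.symm _ _ h2) hbf, hf⟩⟩
    · exact Or.inr ⟨ha, hc⟩

/-- **Lumpability of the junction**: `J(lump P, lump P') = J(P, P')`. [cite: IkhlefPonsaing2012, Def. 4.1] -/
theorem ipJunction_lump_lump (j : Fin (m + 1)) (P P' : ColPattern m) :
    ipJunction m j (lump P) (lump P') = ipJunction m j P P' := by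
  classical
  unfold ipJunction
  rw [decide_eq_decide]
  simp only [lump_snd]
  constructor
  · rintro ⟨f, hjf, hf⟩
    rcases eqvGen_junction_lump P P' j f hjf with h | ⟨h, -⟩
    · exact ⟨f, h, hf⟩
    · exact h
  · rintro ⟨f, hjf, hf⟩
    refine ⟨f, Relation.EqvGen.mono (fun a b h => ?_) _ _ hjf, hf⟩
    rw [lump_fst_eq_true_iff, lump_fst_eq_true_iff]
    exact h.imp Or.inl Or.inl

end Lump

/-! ### Lumped laws, the lumped transfer kernel and the lumped stationary law -/

section LumpLaw

open Finset

variable {m : ℕ}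

/-- The push-forward of a (signed) vector along lumping. [folklore] -/
noncomputable def lumpLaw (μ : ColPattern m → ℝ) : ColPattern m → ℝ :=
  fun Q => ∑ P ∈ univ.filter (fun P => lump P = Q), μ P

/-- Lumping preserves the total mass. [folklore] -/
theorem sum_lumpLaw (μ : ColPattern m → ℝ) : ∑ Q, lumpLaw μ Q = ∑ P, μ P := by
  unfold lumpLaw
  exact sum_fiberwise univ lump μ

/-- Lumping is linear (differences). [folklore] -/
theorem lumpLaw_sub (μ ν : ColPattern m → ℝ) : lumpLaw (μ - ν) = lumpLaw μ - lumpLaw ν := by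
  funext Q
  simp only [lumpLaw, Pi.sub_apply, sum_sub_distrib]

/-- Lumping preserves nonnegativity. [folklore] -/
theorem lumpLaw_nonneg {μ : ColPattern m → ℝ} (h : ∀ P, 0 ≤ μ P) (Q : ColPattern m) : 0 ≤ lumpLaw μ Q :=
  sum_nonneg fun P _ => h P

/-- Lumping contracts the `ℓ¹` norm. [folklore] -/
theorem l1_lumpLaw_le (x : ColPattern m → ℝ) : l1 (lumpLaw x) ≤ l1 x := by
  unfold l1 lumpLaw
  calc ∑ Q, |∑ P ∈ univ.filter (fun P => lump P = Q), x P|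
      ≤ ∑ Q, ∑ P ∈ univ.filter (fun P => lump P = Q), |x P| :=
        sum_le_sum fun Q _ => abs_sum_le_sum_abs _ _
    _ = ∑ P, |x P| := sum_fiberwise univ lump fun P => |x P|

/-- A vector supported on lump-fixed patterns is its own lumping. [folklore] -/
theorem lumpLaw_eq_self {ν : ColPattern m → ℝ} (h : ∀ Q, lump Q ≠ Q → ν Q = 0) : lumpLaw ν = ν := by
  funext Q
  unfold lumpLaw
  by_cases hQ : lump Q = Q
  · rw [← add_sum_erase (univ.filter fun P => lump P = Q) ν (mem_filter.2 ⟨mem_univ Q, hQ⟩)]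
    rw [sum_eq_zero fun P hP => ?_, add_zero]
    obtain ⟨hPQ, hP⟩ := mem_erase.1 hP
    refine h P fun hPP => hPQ ?_
    calc P = lump P := hPP.symm
      _ = Q := (mem_filter.1 hP).2
  · rw [h Q hQ]
    refine sum_eq_zero fun P hP => h P fun hPP => hQ ?_
    have hPQ := (mem_filter.1 hP).2
    rw [← hPQ, lump_lump]

/-- **The lumped transfer kernel** `T̄_c(Q, Q') = ∑_{lump P' = Q'} T_c(Q, P')`. [cite: IkhlefPonsaing2012, §3.1] -/
noncomputable def ipTransferL (m : ℕ) (c : ℤ) (Q Q' : ColPattern m) : ℝ :=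
  lumpLaw (ipTransfer m c Q) Q'

/-- The lumped kernel only sees the lumped input. [folklore] -/
theorem lumpLaw_ipTransfer_lump (c : ℤ) (P : ColPattern m) :
    lumpLaw (ipTransfer m c (lump P)) = lumpLaw (ipTransfer m c P) := by
  classical
  funext Q'
  unfold lumpLaw
  have key : ∀ X : ColPattern m, ∑ P' ∈ univ.filter (fun P' => lump P' = Q'), ipTransfer m c X P' =
      ∑ U ∈ (latticeLayer m c).powerset,
        if lump (colUpdate m c X (edgeFn m c U)) = Q' then (1 / 2 : ℝ) ^ (2 * m + 1) else 0 := by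
    intro X
    simp only [ipTransfer_eq_sum']
    rw [sum_comm]
    refine sum_congr rfl fun U _ => ?_
    rw [sum_ite_eq]
    simp only [mem_filter, mem_univ, true_and]
  rw [key, key]
  refine sum_congr rfl fun U _ => ?_
  rw [lump_colUpdate_lump]

/-- The lumped push: `(μ̄ T̄_c)(Q') = ∑_Q μ̄(Q) T̄_c(Q, Q')`. [cite: IkhlefPonsaing2012, §3.1] -/
noncomputable def pushLawL (m : ℕ) (c : ℤ) (μ : ColPattern m → ℝ) : ColPattern m → ℝ :=
  fun Q' => ∑ Q : ColPattern m, μ Q * ipTransferL m c Q Q'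

/-- **Lumpability (law form)**: lumping intertwines the push by `T_c` and the lumped push:
`lump_* (μ T_c) = (lump_* μ) T̄_c`. [cite: IkhlefPonsaing2012, §3.1] -/
theorem lumpLaw_pushLaw (c : ℤ) (μ : ColPattern m → ℝ) :
    lumpLaw (pushLaw m c μ) = pushLawL m c (lumpLaw μ) := by
  classical
  funext Q'
  simp only [pushLawL, ipTransferL]
  have h1 : lumpLaw (pushLaw m c μ) Q' = ∑ P, μ P * lumpLaw (ipTransfer m c P) Q' := by
    simp only [lumpLaw, pushLaw, mul_sum]
    exact sum_comm
  rw [h1]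
  simp only [lumpLaw]
  rw [← sum_fiberwise univ lump fun P => μ P * ∑ P' ∈ univ.filter (fun P' => lump P' = Q'), ipTransfer m c P P']
  refine sum_congr rfl fun Q _ => ?_
  rw [sum_mul]
  refine sum_congr rfl fun P hP => ?_
  have hPQ : lump P = Q := (mem_filter.1 hP).2
  have := congrFun (lumpLaw_ipTransfer_lump c P) Q'
  simp only [lumpLaw] at this
  rw [← this, hPQ]

/-- The lumped push is linear (differences). [folklore] -/
theorem pushLawL_sub (c : ℤ) (μ ν : ColPattern m → ℝ) :
    pushLawL m c (μ - ν) = pushLawL m c μ - pushLawL m c ν := by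
  funext Q'
  simp only [pushLawL, Pi.sub_apply, sub_mul, sum_sub_distrib]

/-- **The lumped stationary law** `π̄_m := lump_* π_m` (IP12's normalised ground state `Ψ/Z` on
`LP_{2m+1}`, in the cluster language). [cite: IkhlefPonsaing2012, §3.4] -/
noncomputable def ipStationaryL (m : ℕ) : ColPattern m → ℝ := lumpLaw (ipStationary m)

/-- `π̄ ≥ 0`. [folklore] -/
theorem ipStationaryL_nonneg (Q : ColPattern m) : 0 ≤ ipStationaryL m Q :=
  lumpLaw_nonneg ipStationary_nonneg Q

/-- `∑ π̄ = 1`. [folklore] -/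
theorem sum_ipStationaryL : ∑ Q, ipStationaryL m Q = 1 := by
  rw [ipStationaryL, sum_lumpLaw, sum_ipStationary]

/-- `π̄` is supported on lump-fixed patterns. [folklore] -/
theorem ipStationaryL_eq_zero_of_lump_ne (Q : ColPattern m) (h : lump Q ≠ Q) : ipStationaryL m Q = 0 := by
  unfold ipStationaryL lumpLaw
  refine sum_eq_zero fun P hP => ?_
  exfalso
  have hPQ := (mem_filter.1 hP).2
  exact h (by rw [← hPQ, lump_lump])

/-- **Stationarity of the lumped law**: `π̄ = π̄ T̄₀ T̄₁`. [cite: IkhlefPonsaing2012, §3.4, eq. (TPsi)] -/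
theorem pushLawL_pushLawL_ipStationaryL :
    pushLawL m 1 (pushLawL m 0 (ipStationaryL m)) = ipStationaryL m := by
  rw [ipStationaryL, ← lumpLaw_pushLaw, ← lumpLaw_pushLaw, pushLaw_pushLaw_ipStationary]

/-- **Uniqueness of the lumped stationary law**: a vector of total mass `1`, supported on
lump-fixed patterns and fixed by `T̄₀ T̄₁`, is `π̄` (Doeblin contraction upstairs, lumping is an
`ℓ¹` contraction intertwining the pushes). [cite: IkhlefPonsaing2012, §3.4] -/
theorem eq_ipStationaryL_of_fixed (ν : ColPattern m → ℝ) (hν1 : ∑ Q, ν Q = 1)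
    (hsupp : ∀ Q, lump Q ≠ Q → ν Q = 0)
    (hfix : pushLawL m 1 (pushLawL m 0 ν) = ν) : ν = ipStationaryL m := by
  set ε := (1 / 2 : ℝ) ^ ((m + 1) * (m + 1)) with hε
  have hε0 : 0 < ε := by positivity
  have hε1 : ε ≤ 1 := pow_le_one₀ (by norm_num) (by norm_num)
  -- upstairs iterates of the signed vector `ν - π`
  set f : (ColPattern m → ℝ) → (ColPattern m → ℝ) := fun x => pushLaw m 1 (pushLaw m 0 x) with hf
  set x₀ : ColPattern m → ℝ := ν - ipStationary m with hx₀
  have hsum0 : ∀ n, ∑ P, (f^[n] x₀) P = 0 := by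
    intro n
    induction n with
    | zero =>
      simp only [Function.iterate_zero, id_eq, hx₀, Pi.sub_apply, sum_sub_distrib, hν1,
        sum_ipStationary, sub_self]
    | succ n ih => rw [Function.iterate_succ_apply', hf, sum_pushLaw, sum_pushLaw, ih]
  have hcontr : ∀ n, l1 (f^[n] x₀) ≤ ((1 - ε) * (1 - ε)) ^ n * l1 x₀ := by
    intro n
    induction n with
    | zero => simp
    | succ n ih =>
      rw [Function.iterate_succ_apply']
      have h0 : ∑ P, pushLaw m 0 (f^[n] x₀) P = 0 := by rw [sum_pushLaw, hsum0]
      calc l1 (pushLaw m 1 (pushLaw m 0 (f^[n] x₀)))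
          ≤ (1 - ε) * l1 (pushLaw m 0 (f^[n] x₀)) := l1_pushLaw_le 1 _ h0
        _ ≤ (1 - ε) * ((1 - ε) * l1 (f^[n] x₀)) :=
            mul_le_mul_of_nonneg_left (l1_pushLaw_le 0 _ (hsum0 n)) (sub_nonneg.2 hε1)
        _ ≤ (1 - ε) * ((1 - ε) * (((1 - ε) * (1 - ε)) ^ n * l1 x₀)) :=
            mul_le_mul_of_nonneg_left (mul_le_mul_of_nonneg_left ih (sub_nonneg.2 hε1)) (sub_nonneg.2 hε1)
        _ = ((1 - ε) * (1 - ε)) ^ (n + 1) * l1 x₀ := by ring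
  -- downstairs the iterates are constant, equal to `ν - π̄`
  have hlump : ∀ n, lumpLaw (f^[n] x₀) = ν - ipStationaryL m := by
    intro n
    induction n with
    | zero => rw [Function.iterate_zero, id_eq, hx₀, lumpLaw_sub, lumpLaw_eq_self hsupp, ipStationaryL]
    | succ n ih =>
      rw [Function.iterate_succ_apply', hf]
      show lumpLaw (pushLaw m 1 (pushLaw m 0 (f^[n] x₀))) = _
      rw [lumpLaw_pushLaw, lumpLaw_pushLaw, ih, pushLawL_sub, pushLawL_sub, hfix,
        pushLawL_pushLawL_ipStationaryL]
  have hbound : ∀ n, l1 (ν - ipStationaryL m) ≤ ((1 - ε) * (1 - ε)) ^ n * l1 x₀ := fun n =>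
    (hlump n ▸ l1_lumpLaw_le (f^[n] x₀)).trans (hcontr n)
  have hl1nn : 0 ≤ l1 (ν - ipStationaryL m) := sum_nonneg fun P _ => abs_nonneg _
  have hx₀nn : 0 ≤ l1 x₀ := sum_nonneg fun P _ => abs_nonneg _
  have hq1 : (1 - ε) * (1 - ε) < 1 := by nlinarith
  have hq0 : 0 ≤ (1 - ε) * (1 - ε) := mul_nonneg (sub_nonneg.2 hε1) (sub_nonneg.2 hε1)
  have hlim : Filter.Tendsto (fun n => ((1 - ε) * (1 - ε)) ^ n * l1 x₀) Filter.atTop (nhds 0) := by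
    simpa using (tendsto_pow_atTop_nhds_zero_of_lt_one hq0 hq1).mul_const (l1 x₀)
  have hl1 : l1 (ν - ipStationaryL m) = 0 :=
    le_antisymm (ge_of_tendsto' hlim hbound) hl1nn
  funext Q
  have := (sum_eq_zero_iff_of_nonneg fun P _ => abs_nonneg ((ν - ipStationaryL m) P)).1 hl1 Q (mem_univ Q)
  rw [abs_eq_zero, Pi.sub_apply, sub_eq_zero] at this
  exact this

/-- **The stationary pairing descends to the lumped laws** (`J` is lumpable). [cite: IkhlefPonsaing2012, Def. 4.1] -/
theorem sum_ipStationary_pairing_eq_lumped (j : Fin (m + 1)) :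
    ∑ P : ColPattern m, ∑ P' : ColPattern m,
        ipStationary m P * ipStationary m P' * (if ipJunction m j P P' = true then (1 : ℝ) else 0) =
      ∑ Q : ColPattern m, ∑ Q' : ColPattern m,
        ipStationaryL m Q * ipStationaryL m Q' * (if ipJunction m j Q Q' = true then (1 : ℝ) else 0) := by
  classical
  simp only [ipStationaryL, lumpLaw]
  symm
  calc ∑ Q, ∑ Q', (∑ P ∈ univ.filter (fun P => lump P = Q), ipStationary m P) *
          (∑ P' ∈ univ.filter (fun P' => lump P' = Q'), ipStationary m P') *
            (if ipJunction m j Q Q' = true then (1 : ℝ) else 0)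
      = ∑ Q, ∑ P ∈ univ.filter (fun P => lump P = Q), ∑ Q', ∑ P' ∈ univ.filter (fun P' => lump P' = Q'),
          ipStationary m P * ipStationary m P' *
            (if ipJunction m j (lump P) (lump P') = true then (1 : ℝ) else 0) := by
        refine sum_congr rfl fun Q _ => ?_
        rw [sum_comm]
        refine sum_congr rfl fun Q' _ => ?_
        rw [sum_mul, sum_mul]
        refine sum_congr rfl fun P hP => ?_
        rw [mul_sum, sum_mul]
        refine sum_congr rfl fun P' hP' => ?_
        rw [(mem_filter.1 hP).2, (mem_filter.1 hP').2]
    _ = ∑ P, ∑ P', ipStationary m P * ipStationary m P' *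
            (if ipJunction m j (lump P) (lump P') = true then (1 : ℝ) else 0) := by
        rw [sum_fiberwise univ lump]
        refine sum_congr rfl fun P _ => ?_
        exact sum_fiberwise univ lump fun P' => ipStationary m P * ipStationary m P' *
          (if ipJunction m j (lump P) (lump P') = true then (1 : ℝ) else 0)
    _ = _ := by simp only [ipJunction_lump_lump]

/-- **Ikhlef–Ponsaing's Prop. 4.7 in lumped form.** The named fact is equivalent to the identities
`∑_{Q,Q'} π̄_m(Q) π̄_m(Q') J_m(Q, Q') = ipSpDim(2m) ipSpDim(2m+2) / ipSpDim(2m+1)²` (`m ∈ ℕ`) for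
the LUMPED stationary laws `π̄_m` — probability vectors on the `C_{m+1}` non-crossing partitions of
the `m + 1` even-column sites (`= |LP_{2m+1}|`), the unique fixed vectors of the lumped two-row
kernels `T̄₀ T̄₁` (`eq_ipStationaryL_of_fixed`); this is IP12's `⟨Ψ|ρ|Ψ⟩/⟨Ψ|Ψ⟩ = χ_{L-1} χ_{L+1} / χ_L²`
at the homogeneous point, whose proof is the `q`KZ computation of IP12 §3.3–§4.4.
[cite: IkhlefPonsaing2012, Def. 4.1, Props. 4.5, 4.7] -/
theorem ikhlefPonsaingFirstPassage_iff_lumped_pairing :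
    IkhlefPonsaingFirstPassage ↔ ∀ m : ℕ,
      ∑ Q : ColPattern m, ∑ Q' : ColPattern m,
        ipStationaryL m Q * ipStationaryL m Q' * (if ipJunction m (Fin.last m) Q Q' = true then 1 else 0) =
      ((Literature.Combinatorics.Enumerative.ipSpDim (2 * m) *
          Literature.Combinatorics.Enumerative.ipSpDim (2 * m + 2) /
          Literature.Combinatorics.Enumerative.ipSpDim (2 * m + 1) ^ 2 : ℚ) : ℝ) := by
  rw [ikhlefPonsaingFirstPassage_iff_stationary_pairing]
  refine forall_congr' fun m => ?_
  rw [sum_ipStationary_pairing_eq_lumped]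

end LumpLaw

end Literature.Probability.Percolation
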